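import Summits.BirchSwinnertonDyer.BirchSwinnertonDyer.Theorems.Rank2ObservatoryThreeIsoRowsA
import Summits.BirchSwinnertonDyer.BirchSwinnertonDyer.Theorems.Rank2ObservatoryThreeIsoRowsB
import Summits.BirchSwinnertonDyer.BirchSwinnertonDyer.Theorems.Rank2ObservatoryThreeIsoRowsC
import HarnessLib

/-!
# BirchSwinnertonDyer — rank ≥ 2 observatory: KERNEL-3ISO census (435 curves of the `ℤ/3` stratum with `rank_ℤ = 2` hypothesis-free)

HONEST FRAMING: per-curve certified theorems and census instruments; no claim on BSD in rank ≥ 2.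

`threeIsoRows` = the 435 rows of Cremona's rank-2 table (conductors `5427 … 499662`, labels `5427b1 … 499662g2`) with
`E(ℚ)_tors = ℤ/3` whose `3`-isogeny descent closes with the E-side `2`-adic kills alone (feasibility census `k3iso`:
`#S · #S' < 3⁴` with `S'` the full support-law set) — 435 of the 3539 rows with `E(ℚ)_tors = ℤ/3` (3811 rows have a rational
`3`-torsion point); the other 3104 need Ê-side local kills over `K = ℚ(ζ₃)` (Cohen–Pazuki, Thm. 4.1; 654 of them also further
E-side kills), not attempted here. For EVERY row of `threeIsoRows` both rank fields of the census are kernel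
theorems (`forall_mem_threeIsoRows_rank_eq_two`: `rank_ℤ E(ℚ) = 2` with NO hypothesis), hence `L(E,1) = L′(E,1) = 0` from
`hGZK` alone and `r_an = rank_ℤ = 2` from `hGZK` + `hL2`. This file only concatenates the lists of
`Rank2ObservatoryThreeIsoRowsA|B|C` (29 per-row chunk files `Rows01 … 29` underneath); no new mathematical content;
axioms standard.
References: J. E. Cremona, *Algorithms for Modular Elliptic Curves* (2nd ed. 1997), Table 1, §2.13; H. Cohen, *Number Theory I*
(GTM 239), Prop. 8.4.8; H. Cohen, F. Pazuki, Acta Arith. 140 (2009), Prop. 2.2, Thm. 3.1, Thm. 4.1; H. Darmon (2004), Thm. 3.22.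
-/

namespace Summit.BirchSwinnertonDyer.BirchSwinnertonDyer.Rank2Observatory

open WeierstrassCurve Literature.NumberTheory.EllipticCurves Literature.NumberTheory.EllipticCurves.MordellDescent

/-- **The KERNEL-3ISO census list**: all 435 rows (conductor-ascending). DATA. [cite: CremonaAlgorithms1997, Table 1] -/
def threeIsoRows : List Rank2Row :=
  threeIsoRowsA ++ threeIsoRowsB ++ threeIsoRowsC

/-- `threeIsoRows` has `435` rows (`150 + 150 + 135`). [folklore] -/
theorem threeIsoRows_length : threeIsoRows.length = 435 := by
  simp only [threeIsoRows, List.length_append, threeIsoRowsA_length, threeIsoRowsB_length, threeIsoRowsC_length]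

/-- Every row of `threeIsoRows` is a row of the census table `rank2Table`. [folklore] -/
theorem forall_mem_threeIsoRows_mem_rank2Table : ∀ r ∈ threeIsoRows, r ∈ rank2Table := by
  intro r hr
  rw [threeIsoRows] at hr
  rcases List.mem_append.1 hr with h | h
  · rcases List.mem_append.1 h with h | h
    · exact forall_mem_threeIsoRowsA_mem_rank2Table r h
    · exact forall_mem_threeIsoRowsB_mem_rank2Table r h
  · exact forall_mem_threeIsoRowsC_mem_rank2Table r h

/-- **THE KERNEL-3ISO CENSUS THEOREM: `rank_ℤ E(ℚ) = 2` with NO hypothesis for every one of the 435 rows of `threeIsoRows`**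
(`hup` by `3`-isogeny descent, `hlow` by kernel certificate). [cite: CremonaAlgorithms1997, Table 1] [cite: Cohen2007NumberTheoryI, Prop. 8.4.8]
[cite: CohenPazuki2009, Prop. 2.2, Thm. 3.1] -/
theorem forall_mem_threeIsoRows_rank_eq_two : ∀ r ∈ threeIsoRows, r.curve.mordellWeilRank = 2 := by
  intro r hr
  rw [threeIsoRows] at hr
  rcases List.mem_append.1 hr with h | h
  · rcases List.mem_append.1 h with h | h
    · exact forall_mem_threeIsoRowsA_rank_eq_two r h
    · exact forall_mem_threeIsoRowsB_rank_eq_two r h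
  · exact forall_mem_threeIsoRowsC_rank_eq_two r h

/-- `L(E,1) = L′(E,1) = 0` EXACTLY for every row of `threeIsoRows`, from `hGZK` alone. [cite: CremonaAlgorithms1997, §2.13] [cite: Darmon2004, Thm. 3.22] -/
theorem forall_mem_threeIsoRows_lvalue_lderiv_eq_zero (hGZK : rank_eq_analyticRank_of_analyticRank_le_one) :
    ∀ r ∈ threeIsoRows, r.curve.entireLFunction 1 = 0 ∧ deriv r.curve.entireLFunction 1 = 0 :=
  fun r hr => lvalue_lderiv_eq_zero_of_mem_rank2Table (forall_mem_threeIsoRows_mem_rank2Table r hr) hGZK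

/-- **`r_an = rank_ℤ` and `r_an = 2` for every row of `threeIsoRows`** given `hGZK` and the row's one remaining certificate
field `hL2 : L″(E,1) ≠ 0`. [cite: CremonaAlgorithms1997, §2.13] [cite: Darmon2004, Thm. 3.22] -/
theorem forall_mem_threeIsoRows_analyticRank_eq_rank (hGZK : rank_eq_analyticRank_of_analyticRank_le_one) :
    ∀ r ∈ threeIsoRows, iteratedDeriv 2 r.curve.entireLFunction 1 ≠ 0 →
      r.curve.analyticRank = r.curve.mordellWeilRank ∧ r.curve.analyticRank = 2 :=
  fun r hr hL2 => analyticRank_eq_rank_of_mem_rank2Table (forall_mem_threeIsoRows_mem_rank2Table r hr) hGZK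
    (forall_mem_threeIsoRows_rank_eq_two r hr).le hL2

end Summit.BirchSwinnertonDyer.BirchSwinnertonDyer.Rank2Observatory
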